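import Literature.AlgebraicGeometry.Frobenioids.ArchimedeanPointBase
import Literature.AlgebraicGeometry.Frobenioids.ArchimedeanFSMProofs
import Literature.AlgebraicGeometry.Frobenioids.ArchimedeanFSMMonoCondBR
import Literature.AlgebraicGeometry.Frobenioids.ArchimedeanFSMLifting
import Literature.AlgebraicGeometry.Frobenioids.ArchimedeanFSMOverIsoProofs
import Literature.AlgebraicGeometry.Frobenioids.ArchimedeanFSMIrreducible
import Literature.AlgebraicGeometry.Frobenioids.ArchimedeanFSMPullbackFSMI
import Literature.AlgebraicGeometry.Frobenioids.ArchimedeanFSMFFComplexRegime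
import Literature.AlgebraicGeometry.Frobenioids.ArchimedeanFSMIrreducibleCounterexample
import Literature.AlgebraicGeometry.Frobenioids.ArchimedeanBaseComparison
import Literature.AlgebraicGeometry.Frobenioids.CategoriesFactorizationRevised
import Mathlib.CategoryTheory.Groupoid
import HarnessLib

/-!
# Frobenioids II, Proposition 3.4 (i)–(viii) AS TYPED holds over EVERY base with invertible arrows
# (groupoid, discrete and one-object bases, real or complex) — abc-iut cell, layer L1, node
# `FrdII:Prop3.4` (S6 lineage), chain LC-L1-2

Mochizuki, *The geometry of Frobenioids II: poly-Frobenioids*, Kyushu J. Math. **62** (2008) 401–460, §3,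
Proposition 3.4 (i)–(viii) pp. 29–33 [cite: MochizukiFrdII2008, Prop 3.4 p.30]; the bases «one-morphism
category determined by `Spec(K_v)`» of *Inter-universal Teichmüller theory I*, Example 3.4 (i), kurims text
p. 80 [cite: Mochizuki2012, Ex 3.4 (i) p.80].

PROOF-ONLY file (no `def`), abc-iut-L1-d3 (holder of the S6 sub-DAG `FrdII:Prop3.4`).  RECORD.  The typed
items `ArchFrd.Prop34_i … Prop34_viii π` (abc-iut-L1-t6) quantify over an arbitrary base `π : D ⥤ D₀`;
three are false at SOME base — (iii), (viii) at `π = 𝟭 D₀` (`not_prop34_iii_id`, `not_prop34_viii_id`,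
abc-iut-L1-d3), (v) at the constant real base on `Type` (`not_prop34_v_constReal`, abc-iut-w4-d092).  This
file locates the failures: EVERY ONE of them needs a NON-INVERTIBLE arrow of the base (the structure arrow
`Spec ℂ → Spec ℝ` of `D₀`, resp. a non-epimorphism of `Type`).  Precisely: **if every arrow of `D` is
invertible, all eight typed items hold over `π : D ⥤ D₀`, with no further hypothesis**
(`prop34_of_isIso_hom`), hence over every groupoid base (`prop34_groupoid`), every discrete base
(`prop34_discrete` — every «one-morphism category determined by `Spec(K_v)`», real OR complex, and every
disjoint union of such), the IUT archimedean base `ptBase` (= `prop34_discrete ptBase`; landed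
separately as `ArchFrd.prop34_ptBase`, `ArchimedeanPointBaseProp34.lean`) and the one-object REAL base (`prop34_realPoint`, to be compared with
`not_prop34_v_constReal` over the non-totally-epimorphic base `Type`).  Route: (i) (ii) (iv) (vii) hold over
every base (`prop34_i_holds`, `prop34_ii_holds` [abc-iut-w5-d101], `prop34_iv_holds` [w5-d101],
`prop34_vii_holds`); (iii): an invertible arrow is an FSM-morphism; (v): invertible ⇒ epi, so `D` is totally
epimorphic (`prop34_v_of_isTotallyEpimorphic`, abc-iut-w4-d092); (vi) ⇐ (iii) (`prop34_vi_of_prop34_iii`);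
(viii): either every object lies over `Spec ℂ` — the complex regime, `D` being of FSM-type hence
FSMFF-2024 (`prop34_viii_of_isComplex`, abc-iut-w5-d152) — or some object lies over `Spec ℝ`, and then `D`
is NOT complexifiable (a complexifying arrow `B → A` would be an invertible arrow over `Spec ℂ → Spec ℝ`,
but `Hom_{D₀}(Spec ℝ, Spec ℂ) = ∅`), so the typed (viii), an implication from «`D` complexifiable», holds
with a refuted antecedent (honest label: vacuous in that case, `not_isComplexifiable_of_isIso_hom_of_real`).

Honest framing: classical, undisputed mathematics ([FrdII] is a refereed prerequisite); nothing here bears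
on [IUTchIII] Cor. 3.12; typed ≠ proved elsewhere; here every statement is a kernel theorem.
-/

namespace Literature.AlgebraicGeometry.Frobenioids

namespace ArchFrd

open CategoryTheory

universe v u

variable {D : Type u} [Category.{v} D] (π : D ⥤ D0)

/-! ### Bases with invertible arrows: the three structural facts -/

/-- An invertible arrow is an FSM-morphism (fiberwise-surjective: complete `γ` by `γ ≫ β⁻¹`; mono).
[cite: MochizukiFrdI2008, §0 p.14] -/
private theorem isFSM_of_isIso_aux {C : Type*} [Category C] {X Y : C} (f : X ⟶ Y) [IsIso f] :
    IsFSM f :=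
  ⟨fun Z γ => ⟨Z, γ ≫ inv f, 𝟙 Z, by simp⟩, inferInstance⟩

/-- A category all of whose arrows are invertible is totally epimorphic ([FrdI] §0 p. 15).
[cite: MochizukiFrdI2008, §0 p.15] -/
theorem isTotallyEpimorphic_of_isIso_hom (hD : ∀ {X Y : D} (f : X ⟶ Y), IsIso f) :
    IsTotallyEpimorphic D :=
  ⟨fun f => by haveI := hD f; infer_instance⟩

/-- A category all of whose arrows are invertible is of FSM-type ([FrdI] §0 p. 14), hence of FSMFF-type in
the revised (2024) sense. [cite: MochizukiFrdI2008, §0 p.14] -/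
theorem isOfFSMType_of_isIso_hom (hD : ∀ {X Y : D} (f : X ⟶ Y), IsIso f) : IsOfFSMType D :=
  ⟨fun f _ => hD f⟩

/-- Over `D₀` there is no arrow `Spec ℝ → Spec ℂ`; hence a base all of whose arrows are invertible and which
has an object over `Spec ℝ` is NOT complexifiable in the sense of [FrdII] Def. 3.1 (v) (a complexifying
arrow `B → A`, `B` over `Spec ℂ`, `A` over `Spec ℝ`, would have an inverse over `Spec ℝ → Spec ℂ`).
[cite: MochizukiFrdII2008, Def 3.1 (v) p.25] -/
theorem not_isComplexifiable_of_isIso_hom_of_real (hD : ∀ {X Y : D} (f : X ⟶ Y), IsIso f)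
    {d : D} (hd : (π.obj d).IsReal) : ¬ RC.IsComplexifiable (π ⋙ D0.toArchBase) := by
  intro hc
  have hdR : RC.realObjects (π ⋙ D0.toArchBase) d := (D0.isReal_toArchBase_iff (π.obj d)).mpr hd
  obtain ⟨B, f, -, hB, -, -⟩ := hc.exists_complex d hdR
  have hBC : (π.obj B).IsComplex := (D0.isComplex_toArchBase_iff (π.obj B)).mp hB
  haveI := hD f
  have g : D0.real ⟶ D0.complex := eqToHom hd.symm ≫ π.map (inv f) ≫ eqToHom hBC
  exact D0.isEmpty_hom_real_complex.false g

/-! ### Item by item over a base with invertible arrows -/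

section IsoBase

variable (hD : ∀ {X Y : D} (f : X ⟶ Y), IsIso f)
include hD

/-- **(iii) over a base with invertible arrows**, for each tower `F ∈ {A, N, R}`: the projection of any
morphism is invertible, hence FSM. [cite: MochizukiFrdII2008, Prop 3.4 (iii) p.30] -/
theorem Tower.propIII_of_isIso_hom (T : Tower π) : T.PropIII := by
  intro X Y φ _
  haveI := hD (T.toD.map φ)
  exact isFSM_of_isIso_aux _

/-- **Prop. 3.4 (iii) AS TYPED over a base with invertible arrows.** [cite: MochizukiFrdII2008, Prop 3.4 (iii) p.30] -/
theorem prop34_iii_of_isIso_hom : Prop34_iii π :=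
  ⟨(towerA π).propIII_of_isIso_hom π hD, (towerN π).propIII_of_isIso_hom π hD,
    (towerR π).propIII_of_isIso_hom π hD⟩

/-- **Prop. 3.4 (v) AS TYPED over a base with invertible arrows** (such a base is totally epimorphic;
abc-iut-w4-d092's `prop34_v_of_isTotallyEpimorphic`). [cite: MochizukiFrdII2008, Prop 3.4 (v) p.30] -/
theorem prop34_v_of_isIso_hom : Prop34_v π :=
  prop34_v_of_isTotallyEpimorphic π (isTotallyEpimorphic_of_isIso_hom hD)

/-- **Prop. 3.4 (vi) AS TYPED over a base with invertible arrows** (main and irreducible clauses hold over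
every base; the FSMI clause follows from (iii): `prop34_vi_of_prop34_iii`). [cite: MochizukiFrdII2008, Prop 3.4 (vi) p.30] -/
theorem prop34_vi_of_isIso_hom : Prop34_vi π :=
  prop34_vi_of_prop34_iii π (prop34_iii_of_isIso_hom π hD)

/-- **(viii) over a base with invertible arrows**, for each tower: either every object lies over `Spec ℂ`
(complex regime: abc-iut-w5-d152's `propVIII_conclusion_of_isComplex` route, through `prop34_viii_of_isComplex`)
or some object lies over `Spec ℝ` and the antecedent «`D` complexifiable» of the typed item is refuted
(`not_isComplexifiable_of_isIso_hom_of_real`) — honest label: the typed implication then holds vacuously.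
[cite: MochizukiFrdII2008, Prop 3.4 (viii) p.30] -/
theorem prop34_viii_of_isIso_hom : Prop34_viii π := by
  by_cases hC : ∀ d : D, (π.obj d).IsComplex
  · exact prop34_viii_of_isComplex π hC (isTotallyEpimorphic_of_isIso_hom hD)
      (isOfFSMType_of_isIso_hom hD).isOfFSMFFType2024
  · push Not at hC
    obtain ⟨d, hd⟩ := hC
    have hdR : (π.obj d).IsReal := by
      rcases hK : π.obj d with _ | _
      · rfl
      · exact absurd hK hd
    have hnc := not_isComplexifiable_of_isIso_hom_of_real π hD hdR
    exact ⟨fun hc _ _ => absurd hc hnc, fun hc _ _ => absurd hc hnc, fun hc _ _ => absurd hc hnc⟩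

/-- **[FrdII] Prop. 3.4 (i)–(viii) AS TYPED hold over EVERY base `π : D ⥤ D₀` all of whose arrows are
invertible** — all eight typed items, all three categories `A`, `N`, `R`, no further hypothesis.
[cite: MochizukiFrdII2008, Prop 3.4 p.30] -/
theorem prop34_of_isIso_hom :
    Prop34_i π ∧ Prop34_ii π ∧ Prop34_iii π ∧ Prop34_iv π ∧
      Prop34_v π ∧ Prop34_vi π ∧ Prop34_vii π ∧ Prop34_viii π :=
  ⟨prop34_i_holds π, prop34_ii_holds π, prop34_iii_of_isIso_hom π hD, prop34_iv_holds π,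
    prop34_v_of_isIso_hom π hD, prop34_vi_of_isIso_hom π hD, prop34_vii_holds π,
    prop34_viii_of_isIso_hom π hD⟩

end IsoBase

/-! ### Corollaries: groupoid bases, discrete bases, the one-object bases (complex and REAL) -/

/-- **Prop. 3.4 (i)–(viii) AS TYPED over every GROUPOID base.** [cite: MochizukiFrdII2008, Prop 3.4 p.30] -/
theorem prop34_groupoid {G : Type u} [Groupoid.{v} G] (ρ : G ⥤ D0) :
    Prop34_i ρ ∧ Prop34_ii ρ ∧ Prop34_iii ρ ∧ Prop34_iv ρ ∧
      Prop34_v ρ ∧ Prop34_vi ρ ∧ Prop34_vii ρ ∧ Prop34_viii ρ :=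
  prop34_of_isIso_hom ρ (fun _ => inferInstance)

/-- **Prop. 3.4 (i)–(viii) AS TYPED over every DISCRETE base** — in particular over every «one-morphism
category determined by `Spec(K_v)`» ([IUTchI] Ex. 3.4 (i)), `K_v` real or complex, and over every disjoint
union of such points. [cite: Mochizuki2012, Ex 3.4 (i) p.80] -/
theorem prop34_discrete {I : Type u} (ρ : Discrete I ⥤ D0) :
    Prop34_i ρ ∧ Prop34_ii ρ ∧ Prop34_iii ρ ∧ Prop34_iv ρ ∧
      Prop34_v ρ ∧ Prop34_vi ρ ∧ Prop34_vii ρ ∧ Prop34_viii ρ :=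
  prop34_of_isIso_hom ρ (fun _ => inferInstance)

-- The IUT archimedean base `ptBase` (one object over `Spec ℂ`) is the instance `prop34_discrete ptBase`;
-- it is ALREADY in the tree as `ArchFrd.prop34_ptBase` (`ArchimedeanPointBaseProp34.lean`, (viii) via the
-- complex regime) and is not restated here.

/-- **The one-object REAL base** `Spec ℝ` (the constant functor `Discrete PUnit ⥤ D₀` at `Spec ℝ`; [FrdII]
Ex. 3.3 allows real `K_v`): all eight typed items hold here too — (v) because the base is totally
epimorphic (contrast: `not_prop34_v_constReal` over the constant real functor on the NON-totally-epimorphic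
base `Type`), (viii) vacuously (a one-object real base is not complexifiable).
[cite: MochizukiFrdII2008, Prop 3.4 p.30] -/
theorem prop34_realPoint :
    let ρ : Discrete PUnit.{1} ⥤ D0 := (Functor.const _).obj D0.real
    Prop34_i ρ ∧ Prop34_ii ρ ∧ Prop34_iii ρ ∧ Prop34_iv ρ ∧
      Prop34_v ρ ∧ Prop34_vi ρ ∧ Prop34_vii ρ ∧ Prop34_viii ρ :=
  prop34_discrete _

/-- The one-object real base is NOT complexifiable (so the typed (viii) is vacuous there — honest label),
while `D₀` itself is (`D0.rc_isComplexifiable`, abc-iut-L1-t4). [cite: MochizukiFrdII2008, Def 3.1 (v) p.25] -/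
theorem not_isComplexifiable_realPoint :
    ¬ RC.IsComplexifiable (((Functor.const (Discrete PUnit.{1})).obj D0.real) ⋙ D0.toArchBase) :=
  not_isComplexifiable_of_isIso_hom_of_real _ (fun _ => inferInstance) (d := ⟨PUnit.unit⟩) rfl

/-- **Where the typed (v) fails vs. holds**: false over the constant real functor on `Type` (abc-iut-w4-d092),
true over the constant real functor on the one-object category — the difference is exactly total
epimorphicity of the base. [cite: MochizukiFrdII2008, Prop 3.4 (v) p.30] -/
theorem prop34_v_realPoint_and_not_constReal :
    Prop34_v ((Functor.const (Discrete PUnit.{1})).obj D0.real) ∧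
      ¬ Prop34_v ((Functor.const (Type)).obj D0.real) :=
  ⟨(prop34_realPoint).2.2.2.2.1, not_prop34_v_constReal⟩

end ArchFrd

end Literature.AlgebraicGeometry.Frobenioids
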